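import Literature.NumberTheory.Automorphic.PairLFunctionPolesGLOneRatProofs
import HarnessLib

/-!
# Arthur–Clozel (2.3) for `GL_1` over every number field (proofs only)

Topic `NumberTheory/Automorphic`; namespace `Literature.NumberTheory.Automorphic`. Proof file
(theorems only: no definition, no named fact, no instance) under the named fact
`JacquetShalika1981_partialPairL_pole_of_eq_conj` of `PairLFunctionPoles` — Arthur–Clozel,
*Simple algebras, base change, and the advanced theory of the trace formula*, Ann. of Math.
Stud. 120 (1989), Ch. 3 §2, (2.3), p. 171 of the held copy: for unitary cuspidal `π`, `σ` on
`GL_n(𝔸_K)` with `π ≅ σ̃`, "the limit `lim_{s → 1, Re s > 1} (s - 1) L^S(s, π ⊗ σ)` exists and is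
finite and non-zero" — proving it outright in **rank `n = 1` over every number field `K`**
(`JacquetShalika1981_partialPairL_pole_of_eq_conj_one`), extending the case `K = ℚ` of the
sibling file `PairLFunctionPolesGLOneRatProofs` (`…_one_rat`, Mathlib's `riemannZeta_residue_one`).

In rank one a cuspidal automorphic representation of `GL_1(𝔸_K)` is a unitary Hecke character
`χ`, `σ̃ = σ̄` has character `χ_{σ}⁻¹` (`CuspidalAutomorphicRepGL.heckeCharacter_conj`), so
`π = σ̄` forces `χ_π χ_σ = 1` and `L^S(s, π × σ) = L^S(s, 1) = ζ_K^S(s) = ∏'_{v ∉ S} (1 - q_v^{-s})⁻¹`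
(`CuspidalAutomorphicRepGL.partialPairL_eq_tprod_heckeCharacter`), the partial Dedekind zeta
function. Its simple pole at `s = 1` is Hecke's theorem (1917) — the analytic class number formula,
Neukirch, *Algebraic Number Theory*, Ch. VII, Cor. (5.11) (ii) — which the tree **proves**
(`LFunctions.tendsto_sub_one_mul_dedekindZetaCont_holds`, `DedekindZetaNonvanishing`, on top of
Mathlib's real-variable `NumberField.tendsto_sub_one_mul_dedekindZeta_nhdsGT` and the tree's
continuation `LFunctions.NumberField.exists_isDedekindZetaContinuation_holds`), together with the
Euler product `LFunctions.hasProd_dedekindEulerFactor_holds` (Neukirch VII (5.2)):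

* `tprod_eulerFactor_one_eq_dedekindZetaCont_mul_prod` — **`ζ_K^S(s) = ζ_K(s) ∏_{v ∈ S} (1 - q_v^{-s})`**
  on `Re s > 1` (split the Euler product along the finite `S`,
  `multipliable_inv_one_sub_residueCard_cpow_neg`);
* `tendsto_sub_one_mul_tprod_eulerFactor_one_numberField` — **`ζ_K^S` has a simple pole at `s = 1`**:
  `(s - 1) ζ_K^S(s) → res_K ∏_{v ∈ S} (1 - q_v^{-1}) ≠ 0` as `s → 1`, `Re s > 1`
  (`res_K = NumberField.dedekindZeta_residue K > 0`);
* `JacquetShalika1981_partialPairL_pole_of_eq_conj_one` — **the named fact for `n = 1` over `K`**.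

## References

* J. Arthur, L. Clozel, *Simple algebras, base change, and the advanced theory of the trace
  formula*, Ann. of Math. Stud. 120 (1989), Ch. 3 §2, (2.3), p. 171. [ArthurClozelAMS120]
* J. Neukirch, *Algebraic Number Theory*, Grundlehren 322 (1999), Ch. VII, (5.2) and Cor. (5.11).
  [NeukirchANT1999]
* E. Hecke, *Über die Zetafunktion beliebiger algebraischer Zahlkörper*, Nachr. Ges. Wiss.
  Göttingen (1917), 77–89. [Hecke1917]
-/

noncomputable section

open scoped MatrixGroups Topology NNReal
open NumberField IsDedekindDomain MeasureTheory Filter Complex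

namespace Literature.NumberTheory.Automorphic

open AdelicGroupData GaloisRepresentations

variable {K : Type} [Field K] [NumberField K]

/-- `1(ϖ_v) = 1` for the trivial Hecke character (a private copy of
`HeckeCharacter.valueAtUniformizer_one` of `ArtinLFunctionsAbelianProofs`, not imported here; the
sibling `PairLFunctionPolesGLOneRatProofs` keeps its copy private too). [folklore] -/
private theorem valueAtUniformizer_one'' (v : HeightOneSpectrum (𝓞 K)) :
    (1 : HeckeCharacter K).valueAtUniformizer v = 1 := by
  rw [HeckeCharacter.valueAtUniformizer, HeckeCharacter.localComponent_apply,
    HeckeCharacter.one_apply, Units.val_one]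

/-- **The partial Dedekind zeta function**: for a finite set `S` of finite places of `K` and
`Re s > 1`, `ζ_K^S(s) = ∏'_{v ∉ S} (1 - q_v^{-s})⁻¹ = ζ_K(s) · ∏_{v ∈ S} (1 - q_v^{-s})` — the proved
Euler product `LFunctions.hasProd_dedekindEulerFactor_holds` (Neukirch VII (5.2)) split along the
finite `S` (`multipliable_inv_one_sub_residueCard_cpow_neg`), with `ζ_K = dedekindZetaCont K` on
`Re s > 1` (`LFunctions.dedekindZetaCont_eq_dedekindZeta_of_exists` and Hecke's theorem
`LFunctions.NumberField.exists_isDedekindZetaContinuation_holds`). [cite: NeukirchANT1999, Ch. VII (5.2)] -/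
theorem tprod_eulerFactor_one_eq_dedekindZetaCont_mul_prod {S : Set (HeightOneSpectrum (𝓞 K))}
    (hS : S.Finite) {s : ℂ} (hs : 1 < s.re) :
    ∏' v : {v : HeightOneSpectrum (𝓞 K) // v ∉ S}, (1 - ((v.1.residueCard : ℂ) ^ (-s)))⁻¹ =
      LFunctions.dedekindZetaCont K s * ∏ v ∈ hS.toFinset, (1 - ((v.residueCard : ℂ) ^ (-s))) := by
  classical
  set f : HeightOneSpectrum (𝓞 K) → ℂ := fun v => (1 - ((v.residueCard : ℂ) ^ (-s)))⁻¹ with hf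
  have hf0 : ∀ v, f v ≠ 0 := fun v =>
    inv_ne_zero (one_sub_residueCard_cpow_neg_ne_zero v (by linarith))
  -- the Euler product of `ζ_K`, with `ζ_K(s) = dedekindZetaCont K s`
  have hζ : HasProd f (LFunctions.dedekindZetaCont K s) := by
    have hE := LFunctions.hasProd_dedekindEulerFactor_holds (K := K) hs
    have hfun : (fun v : HeightOneSpectrum (𝓞 K) => LFunctions.dedekindEulerFactor K v s) = f := rfl
    rw [hfun, ← LFunctions.dedekindZetaCont_eq_dedekindZeta_of_exists
      (LFunctions.NumberField.exists_isDedekindZetaContinuation_holds K) hs] at hE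
    exact hE
  -- the finitely many factors at `S`
  have hfin : HasProd (S.mulIndicator fun v => (f v)⁻¹) (∏ v ∈ hS.toFinset, (f v)⁻¹) := by
    have h : HasProd (S.mulIndicator fun v => (f v)⁻¹)
        (∏ v ∈ hS.toFinset, S.mulIndicator (fun v => (f v)⁻¹) v) :=
      hasProd_prod_of_ne_finset_one fun v hv =>
        Set.mulIndicator_of_notMem (fun hvS => hv (hS.mem_toFinset.2 hvS)) _
    rwa [Finset.prod_congr rfl fun v hv => Set.mulIndicator_of_mem (hS.mem_toFinset.1 hv) _] at h
  have hsplit : ∀ v, Sᶜ.mulIndicator f v = f v * S.mulIndicator (fun v => (f v)⁻¹) v := by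
    intro v
    by_cases hvS : v ∈ S
    · rw [Set.mulIndicator_of_notMem (fun h => (Set.mem_compl_iff S v).1 h hvS),
        Set.mulIndicator_of_mem hvS, mul_inv_cancel₀ (hf0 v)]
    · rw [Set.mulIndicator_of_mem (Set.mem_compl hvS), Set.mulIndicator_of_notMem hvS, mul_one]
  calc ∏' v : {v : HeightOneSpectrum (𝓞 K) // v ∉ S}, f v.1
      = ∏' v, Sᶜ.mulIndicator f v := tprod_subtype Sᶜ f
    _ = ∏' v, f v * S.mulIndicator (fun v => (f v)⁻¹) v := tprod_congr hsplit
    _ = LFunctions.dedekindZetaCont K s * ∏ v ∈ hS.toFinset, (f v)⁻¹ := (hζ.mul hfin).tprod_eq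
    _ = LFunctions.dedekindZetaCont K s * ∏ v ∈ hS.toFinset, (1 - ((v.residueCard : ℂ) ^ (-s))) := by
      simp only [hf, inv_inv]

/-- **`ζ_K^S` has a simple pole at `s = 1`**: `(s - 1) ζ_K^S(s) → res_K · ∏_{v ∈ S} (1 - q_v^{-1}) ≠ 0`
as `s → 1`, `Re s > 1`, where `res_K = 2^{r₁} (2π)^{r₂} h_K R_K / (w_K √|d_K|) > 0` is the residue of
the Dedekind zeta function (Hecke (1917); Neukirch, Ch. VII, Cor. (5.11) (ii); in the tree
`LFunctions.tendsto_sub_one_mul_dedekindZetaCont_holds`, Mathlib `NumberField.dedekindZeta_residue_pos`).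
This is Arthur–Clozel (2.3) for the pair of trivial characters of `GL_1(𝔸_K)`.
[cite: NeukirchANT1999, Ch. VII Cor. (5.11) (ii)] -/
theorem tendsto_sub_one_mul_tprod_eulerFactor_one_numberField {S : Set (HeightOneSpectrum (𝓞 K))}
    (hS : S.Finite) :
    ∃ c : ℂ, c ≠ 0 ∧ Tendsto (fun s : ℂ => (s - 1) *
      ∏' v : {v : HeightOneSpectrum (𝓞 K) // v ∉ S}, (1 - ((v.1.residueCard : ℂ) ^ (-s)))⁻¹)
      (𝓝[{s : ℂ | 1 < s.re}] 1) (𝓝 c) := by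
  classical
  set E : ℂ → ℂ := fun s => ∏ v ∈ hS.toFinset, (1 - ((v.residueCard : ℂ) ^ (-s))) with hE
  have hEcont : ContinuousAt E 1 := by
    change Tendsto E (𝓝 1) (𝓝 (E 1))
    exact tendsto_finsetProd _ fun v _ =>
      (continuous_one_sub_residueCard_cpow_neg v).continuousAt.tendsto
  have hE1 : E 1 ≠ 0 := Finset.prod_ne_zero_iff.2 fun v _ =>
    one_sub_residueCard_cpow_neg_ne_zero v (by norm_num)
  have hres : (NumberField.dedekindZeta_residue K : ℂ) ≠ 0 := by
    exact_mod_cast NumberField.dedekindZeta_residue_ne_zero K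
  refine ⟨(NumberField.dedekindZeta_residue K : ℂ) * E 1, mul_ne_zero hres hE1, ?_⟩
  have hζ : Tendsto (fun s => (s - 1) * LFunctions.dedekindZetaCont K s) (𝓝[{s : ℂ | 1 < s.re}] 1)
      (𝓝 (NumberField.dedekindZeta_residue K : ℂ)) :=
    (LFunctions.tendsto_sub_one_mul_dedekindZetaCont_holds K).mono_left (nhdsWithin_mono _ fun s hs h1 => by
      rw [Set.mem_setOf_eq, (h1 : s = 1), Complex.one_re] at hs
      exact lt_irrefl _ hs)
  have hlim := hζ.mul (hEcont.tendsto.mono_left nhdsWithin_le_nhds)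
  refine hlim.congr' (eventually_nhdsWithin_of_forall fun s hs => ?_)
  change ((s - 1) * LFunctions.dedekindZetaCont K s) * E s = (s - 1) * _
  rw [tprod_eulerFactor_one_eq_dedekindZetaCont_mul_prod hS hs, mul_assoc]

/-- **Arthur–Clozel (2.3), rank one over every number field, unconditionally**: for cuspidal
`π, π'` of `GL_1(𝔸_K)` (same `L²_cusp`) with `π = π̄'` (`π ≅ σ̃`) and honest Satake families off a
finite `S`, `(s - 1) L^S(s, π × π')` has a finite non-zero limit as `s → 1`, `Re s > 1`: here
`χ_π χ_{π'} = χ_{π'}⁻¹ χ_{π'} = 1` (`CuspidalAutomorphicRepGL.heckeCharacter_conj`),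
`L^S(s, π × π') = ζ_K^S(s)` (`CuspidalAutomorphicRepGL.partialPairL_eq_tprod_heckeCharacter`), and
`ζ_K^S` has a simple pole at `1` (`tendsto_sub_one_mul_tprod_eulerFactor_one_numberField`: Hecke's
class number formula, proved in the tree). The named fact
`JacquetShalika1981_partialPairL_pole_of_eq_conj` for `n = 1` and every number field `K`; the
case `K = ℚ` is `JacquetShalika1981_partialPairL_pole_of_eq_conj_one_rat` of
`PairLFunctionPolesGLOneRatProofs`. [cite: ArthurClozelAMS120, Ch. 3 §2 (2.3)] -/
theorem JacquetShalika1981_partialPairL_pole_of_eq_conj_one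
    {μ : Measure (gl 1 K).automorphicQuotient} [(gl 1 K).IsAutomorphicMeasure μ] :
    JacquetShalika1981_partialPairL_pole_of_eq_conj (n := 1) (K := K) (μ := μ) := by
  intro _ P P' he S hS α β hα hβ
  have hψ : P.heckeCharacter * P'.heckeCharacter = 1 := by
    rw [he, CuspidalAutomorphicRepGL.heckeCharacter_conj, inv_mul_cancel]
  obtain ⟨c, hc, hlim⟩ := tendsto_sub_one_mul_tprod_eulerFactor_one_numberField (K := K) hS
  refine ⟨c, hc, ?_⟩
  have hfun : (fun s : ℂ => (s - 1) * partialPairL S α β s) = fun s : ℂ => (s - 1) *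
      ∏' v : {v : HeightOneSpectrum (𝓞 K) // v ∉ S}, (1 - ((v.1.residueCard : ℂ) ^ (-s)))⁻¹ := by
    funext s
    rw [CuspidalAutomorphicRepGL.partialPairL_eq_tprod_heckeCharacter hα hβ, hψ]
    simp only [valueAtUniformizer_one'', one_mul]
  rw [hfun]
  exact hlim

end Literature.NumberTheory.Automorphic
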